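import Literature.IUT.HodgeTheaters.GenuineFKitMergeInputsAssembly
import HarnessLib

/-!
# [IUTchI] Cor 5.3 (ii)/(iv) / Def 5.2 (i) / Def 3.6 (a): the lift-kind `ℱ`- and `ℱ̲`-slots of the genuine `ℱ`-prime-strip kit at a BAD index
# over racer C's `frobeniusBadAt B I x hx` ([IUTchI] Ex 3.2 for `D`), and the model cases of Cor 5.3 (ii) and (iv) there READ OUT
# (L5 base-merge, racer B FILE 4 «BadSlot» — the bad-index twin of `GenuineFKitMergeInputsAssembly` §3)

S. Mochizuki, *Inter-universal Teichmüller theory I*, kurims manuscript (May 2020), §5 Corollary 5.3 (ii) p. 144 («`Isom(¹𝔉, ²𝔉) → Isom(¹𝔇, ²𝔇)`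
is bijective»), (iv) p. 144 («Let `v ∈ 𝕍^bad` … the natural homomorphism `Aut(ℱ̲_v) → Aut(𝒟_v)` is bijective»; proof p. 144 l. 41 – p. 145
l. 8: «surjectivity follows immediately from the construction of `ℱ̲_v` … it remains to verify injectivity … `α` lies over the identity
self-equivalence of `𝒟_v` … `α` is [isomorphic to] the identity»), Definition 5.2 (i)(a) p. 134 («`‡ℱ_v` is a category `‡𝒞_v` which admits an
equivalence `‡𝒞_v ⥲ 𝒞_v` [where `𝒞_v` is as in Examples 3.2, (iii)]»), Example 3.2 (i) p. 69 («`ℱ̲_v` … base category `𝒟_v`»), (iii) p. 71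
(«`𝒞_v ⊆ ℱ̲_v` … the base-field-theoretic hull»), Definition 3.6 (a) p. 87 ([IUTchI] Cor 5.3 (iv) p.144) [claim: Mochizuki2012, status: disputed]
(D-0012 claim key, series status DISPUTED — a CONSTRUCTION over abc-iut's kit of record and PROOF-ONLY read-outs; nothing of the series is
asserted; no side is taken on [IUTchIII] Cor. 3.12).

## What this file builds (cell abc-iut; sequel on the WINNER's term `genuineFKitOfBadLocal` p496697, per «MERGE WON: C» 04:46:26Z)

At a bad index `x ∈ V̲^bad` racer C's term carries `frobeniusBadAt B I x hx = D.badLocalFrobenioidAt … (I.m2 x hx) (I.m1 x hx).Kt`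
(abc-iut-L5-t2, p442528) whose base `𝒟_v̲` IS `CosetCat ↥(B x hx).H` (`frobeniusBadAt_Dv`, rfl) — the kit of record's own `Π_v̲` at `x`
(`sub_model_eq_of_mem_bad`; here the seam `localDataOfBadPairs_H_of_mem_bad`).  With racer B's lift kind (p495677), `ρ_x` (p496979) and
`cosetCatEquivOfEq` this gives, BY NAME and with no new binder:
* `badBaseEquiv` (the seam equivalence), `badStructureFunctor` (`𝒞_v ⊆ ℱ̲_v ↦ 𝒟_v`: `hull ⋙ toBase` read over the kit's `Π_v̲`),
  `badThStructureFunctor` (`ℱ̲_v ↦ 𝒟_v`: `toBase` read over the kit's `Π_v̲`);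
* the `ℱ`-slot at a bad index `BadLiftFAmbAt` / `badLiftToDAt` (`_obj` rfl ⇒ (S5) `Iso.refl`) and the `ℱ̲`-slot (Def 3.6 (a) datum `ThAmb x`)
  `BadLiftThAmbAt` / `badLiftThToDAt` (the composite `Aut(ℱ̲_v) → Aut(𝒟_v)` of Cor 5.3 (iv) as `(thToF ⋙ toD)`-shaped functor into the ambient);
* READ-OUTS `badLiftAt_model_case_iff` (Cor 5.3 (ii) model case at bad `x`: bijective ↔ `LiftsAll` ∧ `RigidOverBase (hull ⋙ toBase)`) and
  `badLiftThAt_model_case_iff` (Cor 5.3 (iv) shape: bijective ↔ `LiftsAll` ∧ `RigidOverBase toBase` — «every self-equivalence of the merge's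
  `ℱ̲_v` over the identity of `𝒟_v` is `≅ 𝟭`», print p. 144 l. 43 – p. 145 l. 8, the conclusion shape of abc-iut-L5-t4's
  `Cor53.tempered_descend_injective_of_monoidRigid` p493737 read at the merge record's INPUT carrier `I.m1`).
BINDER CENSUS: kit binders {CG, hS, M, hA, hI, B, ΛBad} ∪ {I} ∪ DATA {x, hx : x ∈ V̲^bad}; displayed INPUTS = the named PREDICATES `LiftsAll`,
`RigidOverBase` (NOT proved here; the `ℱ̲_v`-carrier is the merge's INPUT `I.m1`, so both halves at it are statements about that input); FACT
unnamed 0; LAW 0; 0 instance · 0 notation · no new `Prop` fact.  Archimedean indices: NOT here (the arch `𝒟_v` is an Aut-holomorphic orbispace,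
not a coset category; racer C's σ3 slot stands there, labelled).  typed ≠ inhabited ≠ proved; nothing here asserts abc proved or refuted.
-/

noncomputable section

namespace Literature.IUT.HodgeTheaters

open CategoryTheory Literature.AnabelianGeometry.SemiGraphs

section BadSlot

open InitialThetaData

variable {F K Fbar : Type} [Field F] [NumberField F] [Field K] [NumberField K] [Algebra F K]
  [Field Fbar] [Algebra F Fbar] [Algebra K Fbar]
  {E : WeierstrassCurve F} [E.IsElliptic] {l : ℕ} {Pb : BadPlacePredicates K}
  (D : InitialThetaData F K Fbar E l Pb) (CG : D.geom.pe.CuspGalois) (hS : D.CuspClassesNormaliserStable) [Fact l.Prime]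
  (M : D.TorsionMonodromy) (hA : D.geom.pe.ArrowCoveringClaims)
  (hI : ∀ k ∈ D.geom.pe.inertia D.geom.pe.ε1, M.tau (D.geom.embK k) = 0)
  (B : ∀ v, v ∈ D.indexCopyBad → D.BadPairAt v) (ΛBad : ∀ v (h : v ∈ D.indexCopyBad), D.LocalArrowLaw CG hS (B v h).H)
  (I : D.MergeInputs B) (x : D.IndexCopy) (hx : x ∈ D.indexCopyBad)

namespace InitialThetaData

/-- **The bad-index seam**: at `x ∈ V̲^bad` the kit of record's `Π_v̲` IS the pair's `Π_{X̳̲_v̲} = (B x hx).H` (abc-iut-L5-t4 `localDatumAt_H`,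
`localGroupAt_of_mem`; racer C `sub_model_eq_of_mem_bad`). ([IUTchI] Def 3.1 (e) p.63) [claim: Mochizuki2012, status: disputed] -/
theorem localDataOfBadPairs_H_of_mem_bad : (D.localDataOfBadPairs CG hS M hA hI B ΛBad x).H = (B x hx).H := by
  rw [D.localDatumAt_H, D.localGroupAt_of_mem B hx]

/-- **The base seam at a bad index**: `𝒟_v̲ = CosetCat ↥(B x hx).H` of racer C's `frobeniusBadAt` (rfl, `frobeniusBadAt_Dv`) ≌ the coset category
of the kit's `Π_v̲` (racer B `PiTransport.cosetCatEquivOfEq`). ([IUTchI] Ex 3.2 (i) p.70) [claim: Mochizuki2012, status: disputed] -/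
def badBaseEquiv : CosetCat ↥(B x hx).H ≌ CosetCat ↥((D.localDataOfBadPairs CG hS M hA hI B ΛBad x).H) :=
  PiTransport.cosetCatEquivOfEq (D.localDataOfBadPairs_H_of_mem_bad CG hS M hA hI B ΛBad x hx).symm

/-- **`𝒞_v ↦ 𝒟_v` at a bad index READ OVER the kit's `Π_v̲`**: `𝒞_v ⊆ ℱ̲_v` (Ex 3.2 (iii), the hull) followed by `ℱ̲_v ↦ 𝒟_v` (Ex 3.2 (i)) and the
base seam — the structure functor of the Def 5.2 (i)(a) datum `ℱ_v = 𝒞_v` of racer C's `frobeniusBadAt`. ([IUTchI] Ex 3.2 (iii) p.71) [claim: Mochizuki2012, status: disputed] -/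
def badStructureFunctor : (D.frobeniusBadAt B I x hx).Cv ⥤ CosetCat ↥((D.localDataOfBadPairs CG hS M hA hI B ΛBad x).H) :=
  ((D.frobeniusBadAt B I x hx).hull ⋙ (D.frobeniusBadAt B I x hx).toBase) ⋙ (D.badBaseEquiv CG hS M hA hI B ΛBad x hx).functor

/-- **`ℱ̲_v ↦ 𝒟_v` at a bad index READ OVER the kit's `Π_v̲`**: `toBase` of racer C's `frobeniusBadAt` (its `ℱ̲_v` = the merge INPUT `I.m1`)
followed by the base seam — the structure functor of the Def 3.6 (a) datum `ℱ̲_v`. ([IUTchI] Ex 3.2 (i) p.69) [claim: Mochizuki2012, status: disputed] -/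
def badThStructureFunctor : (D.frobeniusBadAt B I x hx).Fv ⥤ CosetCat ↥((D.localDataOfBadPairs CG hS M hA hI B ΛBad x).H) :=
  (D.frobeniusBadAt B I x hx).toBase ⋙ (D.badBaseEquiv CG hS M hA hI B ΛBad x hx).functor

/-- **THE `ℱ`-SLOT OF RECORD AT A BAD INDEX — `FAmb x`**: the lift kind of `𝒞_v` (racer C's `frobeniusBadAt … .Cv`) over the kit's `𝒟_v̲`.
([IUTchI] Def 5.2 (i) p.134) [claim: Mochizuki2012, status: disputed] -/
abbrev BadLiftFAmbAt : Type :=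
  SingleObj ↥(CatIsomorphism.liftSubgroup (D.badStructureFunctor CG hS M hA hI B ΛBad I x hx)
    ((D.baseKitThetaNFOfBadPairs CG hS M hA hI B ΛBad).model x) (D.modelAutToCatAut CG hS M hA hI B ΛBad x))

/-- **THE `ℱ`-SLOT OF RECORD AT A BAD INDEX — `toD x`** (first projection into the kit's ambient).
([IUTchI] Rmk 5.2.1 (i) p.143) [claim: Mochizuki2012, status: disputed] -/
def badLiftToDAt : D.BadLiftFAmbAt CG hS M hA hI B ΛBad I x hx ⥤ (D.baseKitThetaNFOfBadPairs CG hS M hA hI B ΛBad).Amb x :=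
  CatIsomorphism.liftKindToAmb (D.badStructureFunctor CG hS M hA hI B ΛBad I x hx)
    ((D.baseKitThetaNFOfBadPairs CG hS M hA hI B ΛBad).model x) (D.modelAutToCatAut CG hS M hA hI B ΛBad x)

/-- **(S5) at a bad index, DEFINITIONAL**: `toD_model x := Iso.refl _`. ([IUTchI] Rmk 5.2.1 (i) p.143) [claim: Mochizuki2012, status: disputed] -/
theorem badLiftToDAt_obj (X : D.BadLiftFAmbAt CG hS M hA hI B ΛBad I x hx) :
    (D.badLiftToDAt CG hS M hA hI B ΛBad I x hx).obj X = (D.baseKitThetaNFOfBadPairs CG hS M hA hI B ΛBad).model x := rfl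

/-- **THE `ℱ̲`-SLOT (Def 3.6 (a) datum `ThAmb x`) OF RECORD AT A BAD INDEX**: the lift kind of the tempered Frobenioid `ℱ̲_v`
(racer C's `frobeniusBadAt … .Fv` = the merge input `I.m1`) over the kit's `𝒟_v̲`. ([IUTchI] Def 3.6 (a) p.87) [claim: Mochizuki2012, status: disputed] -/
abbrev BadLiftThAmbAt : Type :=
  SingleObj ↥(CatIsomorphism.liftSubgroup (D.badThStructureFunctor CG hS M hA hI B ΛBad I x hx)
    ((D.baseKitThetaNFOfBadPairs CG hS M hA hI B ΛBad).model x) (D.modelAutToCatAut CG hS M hA hI B ΛBad x))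

/-- **`Aut(ℱ̲_v) → Aut(𝒟_v)` at a bad index as a functor into the kit's ambient** (the composite `thToF ⋙ toD` that Cor 5.3 (iv)'s typed
form `FKit.AutTemperedBijective` reads; first projection of the `ℱ̲`-lift kind). ([IUTchI] Cor 5.3 (iv) p.144) [claim: Mochizuki2012, status: disputed] -/
def badLiftThToDAt : D.BadLiftThAmbAt CG hS M hA hI B ΛBad I x hx ⥤ (D.baseKitThetaNFOfBadPairs CG hS M hA hI B ΛBad).Amb x :=
  CatIsomorphism.liftKindToAmb (D.badThStructureFunctor CG hS M hA hI B ΛBad I x hx)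
    ((D.baseKitThetaNFOfBadPairs CG hS M hA hI B ΛBad).model x) (D.modelAutToCatAut CG hS M hA hI B ΛBad x)

/-- `badLiftThToDAt` sends the reference object to the kit's `𝒟_v̲` (definitional). ([IUTchI] Cor 5.3 (iv) p.144) [claim: Mochizuki2012, status: disputed] -/
theorem badLiftThToDAt_obj (X : D.BadLiftThAmbAt CG hS M hA hI B ΛBad I x hx) :
    (D.badLiftThToDAt CG hS M hA hI B ΛBad I x hx).obj X = (D.baseKitThetaNFOfBadPairs CG hS M hA hI B ΛBad).model x := rfl

/-- **[IUTchI] Cor 5.3 (ii), MODEL CASE AT THE `ℱ`-SLOT OF A BAD INDEX, READ OUT**: bijective IFF `LiftsAll` (Π_{C_F}-transporters of the kit's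
`𝒟_v̲` lift to §0-isomorphisms of `𝒞_v`) ∧ `RigidOverBase (hull ⋙ toBase)` (every self-equivalence of `𝒞_v` over the identity of ITS base `𝒟_v` is
`≅ 𝟭`).  Inputs DISPLAYED; nothing asserted. ([IUTchI] Cor 5.3 (ii) p.144) [claim: Mochizuki2012, status: disputed] -/
theorem badLiftAt_model_case_iff :
    Function.Bijective (fun α : SingleObj.star _ ≅ SingleObj.star _ =>
        (show (D.baseKitThetaNFOfBadPairs CG hS M hA hI B ΛBad).model x ≅ (D.baseKitThetaNFOfBadPairs CG hS M hA hI B ΛBad).model x from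
          (D.badLiftToDAt CG hS M hA hI B ΛBad I x hx).mapIso α)) ↔
      CatIsomorphism.LiftsAll (D.badStructureFunctor CG hS M hA hI B ΛBad I x hx)
          ((D.baseKitThetaNFOfBadPairs CG hS M hA hI B ΛBad).model x) (D.modelAutToCatAut CG hS M hA hI B ΛBad x) ∧
        CatIsomorphism.RigidOverBase ((D.frobeniusBadAt B I x hx).hull ⋙ (D.frobeniusBadAt B I x hx).toBase) := by
  rw [← CatIsomorphism.rigidOverBase_comp_equivalence_iff ((D.frobeniusBadAt B I x hx).hull ⋙ (D.frobeniusBadAt B I x hx).toBase)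
    (D.badBaseEquiv CG hS M hA hI B ΛBad x hx)]
  exact CatIsomorphism.mapIso_liftKindToAmb_bijective_iff'

/-- **[IUTchI] Cor 5.3 (iv) SHAPE AT THE `ℱ̲`-SLOT OF A BAD INDEX, READ OUT** («`Aut(ℱ̲_v) → Aut(𝒟_v)` is bijective», `v ∈ 𝕍^bad`): bijective
IFF `LiftsAll` («surjectivity follows immediately from the construction of `ℱ̲_v`», p. 144 l. 41–43 — Π_{C_F}-transporter lifts to the merge's
`ℱ̲_v`) ∧ `RigidOverBase toBase` («`α` over the identity … is the identity», p. 144 l. 43 – p. 145 l. 8; the conclusion shape of abc-iut-L5-t4's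
`Cor53.tempered_descend_injective_of_monoidRigid` at an [EtTh] carrier, here asked of the merge's INPUT carrier `I.m1`).  Inputs DISPLAYED;
nothing asserted. ([IUTchI] Cor 5.3 (iv) p.144) [claim: Mochizuki2012, status: disputed] -/
theorem badLiftThAt_model_case_iff :
    Function.Bijective (fun α : SingleObj.star _ ≅ SingleObj.star _ =>
        (show (D.baseKitThetaNFOfBadPairs CG hS M hA hI B ΛBad).model x ≅ (D.baseKitThetaNFOfBadPairs CG hS M hA hI B ΛBad).model x from
          (D.badLiftThToDAt CG hS M hA hI B ΛBad I x hx).mapIso α)) ↔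
      CatIsomorphism.LiftsAll (D.badThStructureFunctor CG hS M hA hI B ΛBad I x hx)
          ((D.baseKitThetaNFOfBadPairs CG hS M hA hI B ΛBad).model x) (D.modelAutToCatAut CG hS M hA hI B ΛBad x) ∧
        CatIsomorphism.RigidOverBase (D.frobeniusBadAt B I x hx).toBase := by
  rw [← CatIsomorphism.rigidOverBase_comp_equivalence_iff (D.frobeniusBadAt B I x hx).toBase (D.badBaseEquiv CG hS M hA hI B ΛBad x hx)]
  exact CatIsomorphism.mapIso_liftKindToAmb_bijective_iff'

end InitialThetaData

end BadSlot

end Literature.IUT.HodgeTheaters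

end
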